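import Mathlib
import Literature.Analysis.UnboundedOperators.ConjugateOperatorRegularity
import Literature.Analysis.UnboundedOperators.UnitaryRepSpectralMeasure
import Literature.Analysis.UnboundedOperators.FourierSpectrumCalculus
import HarnessLib
import Summits.AtomisticToContinuum.FouriersLaw.Theorems.EmbeddedDrudeMourreMourreDissolutionLAPResolventRegularity
import Summits.AtomisticToContinuum.FouriersLaw.Theorems.EmbeddedDrudeMourreMourreDissolutionLAPExpUnitary
import Summits.AtomisticToContinuum.FouriersLaw.Theorems.EmbeddedDrudeMourreMourreDissolutionLAPFunctionalCalculus

/-!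
# Stub `stub_mourreThresholdLAP` — F3a: the Mourre commutator as a sandwiched resolvent commutator

Item `stmt-AtomisticToContinuum-12594` (crux `MourreDissolution` of route `EmbeddedDrudeMourre`,
sub-problem `FouriersLaw`), line `separable-vertex-faddeev-pair-sector`, stub S6
`stub_mourreThresholdLAP` (Mourre's limiting absorption principle, `C²` form), helper F3a of the
proof map (Mourre 1981; ABG = Amrein–Boutet de Monvel–Georgescu 1996, §7.2–§7.3, here for
unbounded `H` through its bounded resolvent), part 1/2 (algebra; the energy localisation
inequalities and the plateau cutoffs are in `…LAPEnergyLocalisation`).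

Setting: `U(t) = e^{itH}` and `W(x) = e^{iAx}` one-parameter unitary groups, `g` a Schwartz symbol,
`Φ = U.fourierCalculus g = φ(H)` (`φ = g(·/2π)`), `Φ₁ = U.fourierCalculus (energyMul g) = Hφ(H)`,
`R(z) = resolventAt U z = (H - z)⁻¹`, `X(z) = Φ₁ - z Φ` ("`(H - z)φ(H)`"), and the Mourre commutator
`M = U.mourreCommutator A g = Φ [Φ₁, iA] - Φ₁ [Φ, iA]` ("`φ(H)[H, iA]φ(H)`").

* §1 `[S, iA]` is self-adjoint for self-adjoint `S ∈ C¹(A; H)` (the symmetric difference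
  quotients `x⁻¹(𝒲(x)[S] - S)` converge weakly); hence `M = M†` for a real cutoff with
  `Φ, Φ₁ ∈ C¹(A; H)` (Leibniz on `ΦΦ₁ = Φ₁Φ`), and `0 ≤ Re ⟪f, M f⟫` under a Mourre inequality
  (the positivity consumed by the dissipative resolvent of F1);
* §2 `R(z) X(z) = X(z) R(z) = Φ` and THE `M`-IDENTITY
  `M = -X(z) [R(z), iA] X(z)` for every non-real `z` when `H ∈ C¹(A)` (pure `C¹(A)` algebra:
  Leibniz on `R X = Φ`), the bounded substitute for "`φ(H)[H,iA]φ(H) = (H - z̄)… R[H,iA]R …(H - z)`"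
  (headline `mourreCommutator_eq_neg_sandwich`).
-/

noncomputable section

open MeasureTheory Complex Filter Topology Set
open scoped InnerProductSpace ComplexConjugate SchwartzMap FourierTransform ENNReal NNReal

namespace Summit.AtomisticToContinuum.FouriersLaw.Theorems.MourreDissolution

open Literature.Analysis.UnboundedOperators
open Literature.Analysis.UnboundedOperators.UnitaryRep

variable {H : Type*} [NormedAddCommGroup H] [InnerProductSpace ℂ H] [CompleteSpace H]

/-! ## §1. Commutators of self-adjoint operators; `M = M†` and `M ≥ 0` -/

/-- **The commutator of a self-adjoint operator of class `C¹(A; H)` is self-adjoint**: if `S = S†`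
and `x ↦ 𝒲(x)[S] = e^{-iAx} S e^{iAx}` has strong derivative `D` at `0`, then `D = D†`. Indeed
`𝒲(x)[S]` is self-adjoint for real `x` (`star_conjAut`), so the difference quotients
`x⁻¹(𝒲(x)[S] - S)` are symmetric, and they converge weakly to `D` on both sides of the inner
product (ABG Prop. 5.1.7: `(𝒜[S])† = -𝒜[S†]`, i.e. `[S, iA]† = [S†, iA]`).
[cite: AmreinBoutetdeMonvelGeorgescu1996, Prop. 5.1.7] -/
theorem isSelfAdjoint_of_hasCommutator {A : OneParameterUnitaryGroup H} {S D : H →L[ℂ] H}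
    (h : A.HasCommutator S D) (hS : IsSelfAdjoint S) : IsSelfAdjoint D := by
  have hsym : ∀ u w : H, ⟪S u, w⟫_ℂ = ⟪u, S w⟫_ℂ := fun u w => by
    rw [← ContinuousLinearMap.adjoint_inner_right, hS.adjoint_eq]
  have hsymW : ∀ (x : ℝ) (u w : H), ⟪A.conjAut x S u, w⟫_ℂ = ⟪u, A.conjAut x S w⟫_ℂ :=
    fun x u w => by
    rw [← ContinuousLinearMap.adjoint_inner_right, (isSelfAdjoint_conjAut A x hS).adjoint_eq]
  rw [ContinuousLinearMap.isSelfAdjoint_iff_isSymmetric]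
  intro f g
  simp only [ContinuousLinearMap.coe_coe]
  -- `⟪D f, g⟫ = ⟪f, D g⟫` as the common limit of the symmetric difference quotients
  have h1 : Tendsto (fun x : ℝ => ⟪(x⁻¹ : ℝ) • (A.conjAut x S f - S f), g⟫_ℂ) (𝓝[≠] 0)
      (𝓝 ⟪D f, g⟫_ℂ) := by
    have := (h f).tendsto_slope_zero
    simp only [zero_add, conjAut_zero] at this
    exact Filter.Tendsto.inner this tendsto_const_nhds
  have h2 : Tendsto (fun x : ℝ => ⟪f, (x⁻¹ : ℝ) • (A.conjAut x S g - S g)⟫_ℂ) (𝓝[≠] 0)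
      (𝓝 ⟪f, D g⟫_ℂ) := by
    have := (h g).tendsto_slope_zero
    simp only [zero_add, conjAut_zero] at this
    exact Filter.Tendsto.inner tendsto_const_nhds this
  have heq : ∀ x : ℝ, ⟪(x⁻¹ : ℝ) • (A.conjAut x S f - S f), g⟫_ℂ =
      ⟪f, (x⁻¹ : ℝ) • (A.conjAut x S g - S g)⟫_ℂ := fun x => by
    rw [RCLike.real_smul_eq_coe_smul (K := ℂ), RCLike.real_smul_eq_coe_smul (K := ℂ),
      inner_smul_left, inner_smul_right, RCLike.conj_ofReal, inner_sub_left, inner_sub_right,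
      hsymW, hsym]
  simp only [heq] at h1
  exact tendsto_nhds_unique h1 h2

/-- **`[S, iA]` is self-adjoint for self-adjoint `S`** (junk value `0` off `C¹(A; H)` included).
[cite: AmreinBoutetdeMonvelGeorgescu1996, Prop. 5.1.7] -/
theorem isSelfAdjoint_commutatorCLM (A : OneParameterUnitaryGroup H) {S : H →L[ℂ] H}
    (hS : IsSelfAdjoint S) : IsSelfAdjoint (A.commutatorCLM S) := by
  by_cases h : A.IsOfClassC1 S
  · exact isSelfAdjoint_of_hasCommutator h.hasCommutator hS
  · rw [commutatorCLM_of_not h]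
    exact IsSelfAdjoint.zero _

/-- **Leibniz on `ΦΦ₁ = Φ₁Φ`**: for `Φ = g(H/2π)`, `Φ₁ = (energyMul g)(H/2π)` of class `C¹(A; H)`,
`[Φ, iA] Φ₁ + Φ [Φ₁, iA] = [Φ₁, iA] Φ + Φ₁ [Φ, iA]` (both are the commutator of `ΦΦ₁ = Φ₁Φ`).
[cite: AmreinBoutetdeMonvelGeorgescu1996, Prop. 5.1.5] -/
theorem commutatorCLM_fourierCalculus_leibniz_symm {U A : OneParameterUnitaryGroup H} {g : 𝓢(ℝ, ℂ)}
    (h0 : A.IsOfClassC1 (U.fourierCalculus g))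
    (h1 : A.IsOfClassC1 (U.fourierCalculus (energyMul g))) :
    A.commutatorCLM (U.fourierCalculus g) * U.fourierCalculus (energyMul g) +
        U.fourierCalculus g * A.commutatorCLM (U.fourierCalculus (energyMul g)) =
      A.commutatorCLM (U.fourierCalculus (energyMul g)) * U.fourierCalculus g +
        U.fourierCalculus (energyMul g) * A.commutatorCLM (U.fourierCalculus g) := by
  have hL1 := h0.hasCommutator.mul h1.hasCommutator
  have hL2 := h1.hasCommutator.mul h0.hasCommutator
  rw [fourierCalculus_comm U g (energyMul g)] at hL1
  exact hL1.unique hL2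

/-- **The Mourre commutator is self-adjoint**: for a real symbol `g` with `Φ = g(H/2π)` and
`Φ₁ = (energyMul g)(H/2π)` of class `C¹(A; H)` (the first two clauses of `HasMourreEstimateOn`),
`M = Φ[Φ₁, iA] - Φ₁[Φ, iA]` satisfies `M† = [Φ₁, iA]Φ - [Φ, iA]Φ₁ = M` (all four factors are
self-adjoint, and Leibniz on `ΦΦ₁ = Φ₁Φ`). (ABG (7.2.18): `φ(H)[H, iA]φ(H)` is symmetric.)
[cite: AmreinBoutetdeMonvelGeorgescu1996, §7.2 eq. (7.2.18)] -/
theorem isSelfAdjoint_mourreCommutator {U A : OneParameterUnitaryGroup H} {g : 𝓢(ℝ, ℂ)}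
    (hg : ∀ ξ, conj (g ξ) = g ξ) (h0 : A.IsOfClassC1 (U.fourierCalculus g))
    (h1 : A.IsOfClassC1 (U.fourierCalculus (energyMul g))) :
    IsSelfAdjoint (U.mourreCommutator A g) := by
  have hΦ : IsSelfAdjoint (U.fourierCalculus g) := isSelfAdjoint_fourierCalculus U hg
  have hΦ₁ : IsSelfAdjoint (U.fourierCalculus (energyMul g)) :=
    isSelfAdjoint_fourierCalculus U (conj_energyMul_apply hg)
  have hC₀ : IsSelfAdjoint (A.commutatorCLM (U.fourierCalculus g)) :=
    isSelfAdjoint_commutatorCLM A hΦ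
  have hC₁ : IsSelfAdjoint (A.commutatorCLM (U.fourierCalculus (energyMul g))) :=
    isSelfAdjoint_commutatorCLM A hΦ₁
  have key := commutatorCLM_fourierCalculus_leibniz_symm h0 h1
  have key' : A.commutatorCLM (U.fourierCalculus (energyMul g)) * U.fourierCalculus g =
      A.commutatorCLM (U.fourierCalculus g) * U.fourierCalculus (energyMul g) +
        U.fourierCalculus g * A.commutatorCLM (U.fourierCalculus (energyMul g)) -
        U.fourierCalculus (energyMul g) * A.commutatorCLM (U.fourierCalculus g) := by
    rw [key]; abel
  rw [IsSelfAdjoint, mourreCommutator, star_sub, star_mul, star_mul, hΦ.star_eq, hΦ₁.star_eq,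
    hC₀.star_eq, hC₁.star_eq, key']
  abel

/-- **Positivity of the Mourre commutator**: a Mourre inequality `a ‖Φ f‖² ≤ Re ⟪f, M f⟫` with
`0 ≤ a` gives `0 ≤ Re ⟪f, M f⟫` for all `f` (the dissipativity consumed by Mourre's
`(H - z + iεM)⁻¹`). [cite: AmreinBoutetdeMonvelGeorgescu1996, Lemma 7.3.3] -/
theorem re_inner_mourreCommutator_nonneg {U A : OneParameterUnitaryGroup H} {g : 𝓢(ℝ, ℂ)} {a : ℝ}
    (ha : 0 ≤ a)
    (hM : ∀ f : H, a * ‖U.fourierCalculus g f‖ ^ 2 ≤ (⟪f, U.mourreCommutator A g f⟫_ℂ).re)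
    (f : H) : 0 ≤ (⟪f, U.mourreCommutator A g f⟫_ℂ).re :=
  le_trans (mul_nonneg ha (sq_nonneg _)) (hM f)

/-- **`M = M†` and `M ≥ 0` from a strict Mourre estimate** (packaging for an admissible cutoff
`g` of `HasMourreEstimateOn U A J a`, `0 ≤ a`). [cite: AmreinBoutetdeMonvelGeorgescu1996, §7.2 eq. (7.2.16)] -/
theorem isSelfAdjoint_and_nonneg_of_hasMourreEstimateOn {U A : OneParameterUnitaryGroup H} {J : Set ℝ}
    {a : ℝ} (hM : U.HasMourreEstimateOn A J a) (ha : 0 ≤ a) {g : 𝓢(ℝ, ℂ)}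
    (hg : IsRealCutoffOn J g) :
    IsSelfAdjoint (U.mourreCommutator A g) ∧
      ∀ f : H, 0 ≤ (⟪f, U.mourreCommutator A g f⟫_ℂ).re := by
  obtain ⟨h0, h1, hest⟩ := hM g hg
  exact ⟨isSelfAdjoint_mourreCommutator hg.1 h0 h1, re_inner_mourreCommutator_nonneg ha hest⟩

/-! ## §2. `R(z) X(z) = X(z) R(z) = Φ` and the `M`-identity `M = -X(z) [R(z), iA] X(z)` -/

/-- **`R(z) X(z) = Φ`** for `X(z) = Φ₁ - z Φ` (`(H - z) φ(H) = φ₁(H) - z φ(H)` on the whole space).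
[folklore] -/
theorem resolventAt_mul_energyShift (U : OneParameterUnitaryGroup H) (g : 𝓢(ℝ, ℂ)) {z : ℂ}
    (hz : z.im ≠ 0) :
    resolventAt U z * (U.fourierCalculus (energyMul g) - z • U.fourierCalculus g) =
      U.fourierCalculus g := by
  refine ContinuousLinearMap.ext fun f => ?_
  rw [mul_apply_eq_comp, _root_.sub_apply, _root_.smul_apply]
  exact resolventAt_fourierCalculus_energyMul_sub U g hz f

/-- **`X(z) R(z) = Φ`** (functions of `H` commute with the resolvent). [folklore] -/
theorem energyShift_mul_resolventAt (U : OneParameterUnitaryGroup H) (g : 𝓢(ℝ, ℂ)) {z : ℂ}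
    (hz : z.im ≠ 0) :
    (U.fourierCalculus (energyMul g) - z • U.fourierCalculus g) * resolventAt U z =
      U.fourierCalculus g := by
  rw [sub_mul, smul_mul_assoc, fourierCalculus_resolventAt_comm U (energyMul g) hz,
    fourierCalculus_resolventAt_comm U g hz, ← mul_smul_comm, ← mul_sub]
  exact resolventAt_mul_energyShift U g hz

/-- `X(z) = Φ₁ - z Φ` is of class `C¹(A; H)` with `[X(z), iA] = [Φ₁, iA] - z [Φ, iA]`. [folklore] -/
theorem hasCommutator_energyShift {U A : OneParameterUnitaryGroup H} {g : 𝓢(ℝ, ℂ)}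
    (h0 : A.IsOfClassC1 (U.fourierCalculus g))
    (h1 : A.IsOfClassC1 (U.fourierCalculus (energyMul g))) (z : ℂ) :
    A.HasCommutator (U.fourierCalculus (energyMul g) - z • U.fourierCalculus g)
      (A.commutatorCLM (U.fourierCalculus (energyMul g)) -
        z • A.commutatorCLM (U.fourierCalculus g)) := by
  have := h1.hasCommutator.add (h0.hasCommutator.smul (-z))
  simpa only [neg_smul, ← sub_eq_add_neg] using this

/-- **The `M`-identity (Mourre's commutator as a sandwiched resolvent commutator)**: if
`H ∈ C¹(A)` and `Φ = g(H/2π)`, `Φ₁ = (energyMul g)(H/2π)` are of class `C¹(A; H)`, then for every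
non-real `z`, with `X(z) = Φ₁ - z Φ`,
`φ(H)[H, iA]φ(H) := Φ[Φ₁, iA] - Φ₁[Φ, iA] = -X(z) [R(z), iA] X(z)`.
Proof (pure `C¹(A)` algebra): `R X = Φ` and Leibniz give `[Φ, iA] = [R, iA] X + R [X, iA]`, so
`-X [R, iA] X = -X [Φ, iA] + (X R) [X, iA] = -X[Φ, iA] + Φ[X, iA]`, and expanding
`[X, iA] = [Φ₁, iA] - z[Φ, iA]`, `X = Φ₁ - zΦ` the `z`-terms cancel. This is the bounded form of
ABG's `φ(H)[H, iA]φ(H) = -φ(H)(H - z)[R(z), iA](H - z)φ(H)` ((6.2.7) with (7.2.18)).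
[cite: AmreinBoutetdeMonvelGeorgescu1996, §6.2 eq. (6.2.7) and §7.2 eq. (7.2.18)] -/
theorem mourreCommutator_eq_neg_energyShift_mul {U A : OneParameterUnitaryGroup H}
    (hH : U.HamiltonianOfClassC1 A) {g : 𝓢(ℝ, ℂ)} (h0 : A.IsOfClassC1 (U.fourierCalculus g))
    (h1 : A.IsOfClassC1 (U.fourierCalculus (energyMul g))) {z : ℂ} (hz : z.im ≠ 0) :
    U.mourreCommutator A g =
      -((U.fourierCalculus (energyMul g) - z • U.fourierCalculus g) *
          A.commutatorCLM (resolventAt U z) *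
          (U.fourierCalculus (energyMul g) - z • U.fourierCalculus g)) := by
  have hR : A.HasCommutator (resolventAt U z) (A.commutatorCLM (resolventAt U z)) :=
    (isOfClassC1_resolventAt hH hz).hasCommutator
  have hX := hasCommutator_energyShift h0 h1 z
  have hRX := hR.mul hX
  rw [resolventAt_mul_energyShift U g hz] at hRX
  -- `[Φ, iA] = [R, iA] X + R [X, iA]`
  have key := h0.hasCommutator.unique hRX
  have key' : A.commutatorCLM (resolventAt U z) *
      (U.fourierCalculus (energyMul g) - z • U.fourierCalculus g) =
      A.commutatorCLM (U.fourierCalculus g) - resolventAt U z *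
        (A.commutatorCLM (U.fourierCalculus (energyMul g)) -
          z • A.commutatorCLM (U.fourierCalculus g)) := by
    rw [eq_sub_iff_add_eq]
    exact key.symm
  rw [mul_assoc, key', mul_sub, ← mul_assoc _ (resolventAt U z), energyShift_mul_resolventAt U g hz,
    mourreCommutator]
  simp only [sub_mul, mul_sub, smul_mul_assoc, mul_smul_comm]
  abel

/-! ## §3. Headline (registered helper stub) -/

/-- **The Mourre commutator as a sandwiched resolvent commutator, with its self-adjointness and
positivity, headline form** (all binders explicit; registered helper stub of
`stub_mourreThresholdLAP`, S6-PLAN F3a): for `H ∈ C¹(A)` and a real symbol `g` with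
`Φ = g(H/2π)`, `Φ₁ = (energyMul g)(H/2π)` of class `C¹(A; H)`:
(1) `M = U.mourreCommutator A g` is self-adjoint; (2) for every non-real `z`,
`M = -(Φ₁ - zΦ) [R(z), iA] (Φ₁ - zΦ)`; (3) a Mourre inequality `a‖Φf‖² ≤ Re⟪f, Mf⟫`, `0 ≤ a`,
makes `Re ⟪f, M f⟫ ≥ 0`. [cite: AmreinBoutetdeMonvelGeorgescu1996, §7.2 eq. (7.2.18)] -/
theorem mourreCommutator_eq_neg_sandwich :
    ∀ (K : Type) [NormedAddCommGroup K] [InnerProductSpace ℂ K] [CompleteSpace K]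
      (U A : Literature.Analysis.UnboundedOperators.OneParameterUnitaryGroup K) (g : SchwartzMap ℝ ℂ),
      U.HamiltonianOfClassC1 A → (∀ ξ : ℝ, (starRingEnd ℂ) (g ξ) = g ξ) →
      A.IsOfClassC1 (U.fourierCalculus g) →
      A.IsOfClassC1 (U.fourierCalculus (Literature.Analysis.UnboundedOperators.UnitaryRep.energyMul g)) →
        IsSelfAdjoint (U.mourreCommutator A g) ∧
        (∀ z : ℂ, z.im ≠ 0 →
          U.mourreCommutator A g =
            -((U.fourierCalculus (Literature.Analysis.UnboundedOperators.UnitaryRep.energyMul g) -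
                  z • U.fourierCalculus g) *
                A.commutatorCLM
                  (Summit.AtomisticToContinuum.FouriersLaw.Theorems.MourreDissolution.resolventAt U z) *
              (U.fourierCalculus (Literature.Analysis.UnboundedOperators.UnitaryRep.energyMul g) -
                z • U.fourierCalculus g))) ∧
        ∀ a : ℝ, 0 ≤ a →
          (∀ f : K, a * ‖U.fourierCalculus g f‖ ^ 2 ≤ (inner ℂ f (U.mourreCommutator A g f)).re) →
          ∀ f : K, 0 ≤ (inner ℂ f (U.mourreCommutator A g f)).re := by
  intro K _ _ _ U A g hH hg h0 h1
  exact ⟨isSelfAdjoint_mourreCommutator hg h0 h1,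
    fun z hz => mourreCommutator_eq_neg_energyShift_mul hH h0 h1 hz,
    fun a ha hM f => re_inner_mourreCommutator_nonneg ha hM f⟩

end Summit.AtomisticToContinuum.FouriersLaw.Theorems.MourreDissolution
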